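import Summits.QuantumFields.BalabanUV.T4Continuum.Support.NE9CurChartTowerPiLatticeUniformClassW80
import Literature.MathematicalPhysics.QuantumFieldTheory.Balaban1983to89.B11Eq98V0LettersLatticeUniform
import Literature.MathematicalPhysics.QuantumFieldTheory.Balaban1983to89.B11Eq28JcurWindow

/-!
# NE9CurChartTowerPiLatticeUniformClassW80VJ — THE LATTICE-UNIFORM `cur U` CHART ON PRINT's SMALL-FIELD CLASS WITH THE CONCRETE (L3) CURRENT `W80`
# READ AT THE CELL's OWN LETTERS: `ρ := rieszτ φ` (the dualising map of the trace pairing (27)), `τ` the chart's trace, `J := Jcur U` (the background's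
# current (27)/(28)), the V₀-group's (98)-letter `(C_V, R_V) = (C_V(d, M_φ, α₀, ω, Ω), 1/16)` SUPPLIED by `B11Eq98V0LettersLatticeUniform` and `M_J := ω³`
# by `B11Eq28JcurWindow` — so that of (I-7-W80)'s displayed W-letters `(ρc, τc, M_r, M_t, C_V, R_V, J, M_J, Δπ, M_Δ)` ONLY `(Δπ, M_Δ)` REMAIN; cell `pub-balaban`,
# T4-DAG §2 node U3 ∕ §6 NE9, WALL-NE9-P1 §3 (ii)∕(vii); NE9 crux-team (2) leaf prover 01 (`b2b-balaban-t4-ne9-formalise-leaf-01`, gen 97); Summits-side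
# sibling of (I-7-W80) `Support/NE9CurChartTowerPiLatticeUniformClassW80` under this seat's INTERFACE REQUEST NE9 [NE9LEAF01-G97-IFR] (HOME/INBOX.md;
# ruling e34b3e0c (0)); nothing printed asserted

HONEST FRAMING (T4-DAG PAGE 1).  Rung (B)+1 of the FINITE-VOLUME T⁴ programme — NOT infinite volume, NOT a mass gap, NOT the Clay problem.  NE9
(`T4OutputRate.NE9` ∧ `FadingMemory`) is a cell NEW ESTIMATE, NOT PRINTED in [I] = [Balaban1987RG1] (CMP **109**) ∕ [II] = [Balaban1988RG2Cluster]
(CMP **116**), NOT PROVED here («NE9 ⇐ the named binders»; spine PROVED 0∕9).  HONEST DEPENDENCY (cell line, verbatim): continuum YM on T⁴ ⇐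
BetaPertH ∧ nine spine estimates (0/9 proved); BetaPertH ⇐ (D1) ∧ (D4) ∧ CAP+tail; G-an2-4 gates asym, D1 and NE2/3/4.

WHAT THIS FILE PROVES (ONE theorem; 0 def, 0 sorry, axioms standard; composition BY NAME).
**`cur_chart_exists_tower_pi_of_unitary_class_lattice_uniform_W80VJ`** — (I-7-W80) `cur_chart_exists_tower_pi_of_unitary_class_lattice_uniform_W80`
(`∃ α₁ j₁ ε₄ ε_C R_b R′` BEFORE `∀ n η m U …`; `∃ h52 hpos′ hposπ` PRODUCED; (Ψ1)–(Ψ3) of the chart of print's operator (3.122) at the geometric per-level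
profile) with its per-lattice W-letter block `(ρc τc) (‖ρc‖ ≤ M_r) (‖τc‖ ≤ M_t) (hqV : ‖curV0 ρc τc U Y‖ ≤ C_V‖Y‖² on ‖Y‖ < R_V) (J) (‖J‖ ≤ M_J)`
DISCHARGED: the (L3) slot is `W80 (rieszτ φ) τ U H̃_{1,k} C_k ε_C (Jcur U) Δπ` — `rieszτ φ` of `B11Eq98V0primeCurrentSlots` §7 (`τ(ρ(ℓ)X) = ℓ X` under the
fibre convention `⟪φ⁻¹X, φ⁻¹Y⟫ = τ(X⋆Y)`, `‖rieszτ φ‖ ≤ M_φ²`), `τ` the chart's trace read as a continuous functional (contractive: NEW top-level letter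
`C_τ ≤ 1`, print's normalised trace), `Jcur U` the (28) current of the background (`‖Jcur U‖ ≤ ω³j₀ ≤ ω³`, `B11Eq28JcurWindow`, the chart's current
window `j₀ ≤ j₁ ≤ 1`), and the V₀-group bound `‖curV0 (rieszτ φ) τ U Y‖ ≤ C_V‖Y‖²` on `‖Y‖ < 1/16` with
`C_V = 1024(d−1)(ωΩ)³M_φ²(α₀ω² + 1/16) + (d−1)(ωΩ)³(136 + 2ωΩ)M_φ²` from `B11Eq98V0LettersLatticeUniform.curV0_quadBound_lattice_uniform` (print's
plaquette window `‖U(∂p) − 1‖ ≤ αη²`, `α ≤ α₁ ≤ α₀`; `U(b) ∈ U1`, `U(b)⋆ = U(b)⁻¹` from the class; the profile letters `w̄₀ ≤ ω`, `w̲₀⁻¹ ≤ 1 ≤ Ω` from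
`j(b) ≥ n+1`, `L^{n+1}η = 1`, and ONE NEW per-lattice profile display `w̲₁,₂⁻¹ ≤ Ω` for the `lev₁`-weights).  REMAINING DISPLAYED: `Δπ` with `‖Δπ‖ ≤ M_Δ`
([5] (3.119)/(3.132), memo (E)), the (115) profile bounds, (I-7)'s model block.  Exported radii: `α₁ := min α₁ α₀`, `j₁ := min j₁ 1` of (I-7-W80)'s.
DISGUISE TEST: composition of three landed theorems and two norm computations; no inequality of the series proved; NOT the two-background chart, NOT
claimed that Bałaban's 𝐇_k ∕ old terms meet these letters (O-NE9-1; #5 UNRULED); not NE9.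
References (TYPES ∕ loci only): [Balaban1985BackgroundPropagators] (3.35)–(3.37) p. 396, (3.122) p. 420, Thm 3.12 p. 423, Thm 3.13 p. 426;
[Balaban1985Variational] (27)–(28) p. 282, (80) p. 290, (84)–(96) pp. 290–292, Prop. 4 (97)–(98) p. 293, (103) p. 293, Prop. 6 (117)–(121) p. 295;
[Balaban1985Averaging] (18) p. 21, Prop. 2 p. 26.
-/

noncomputable section

open Metric Set

namespace Summit.QuantumFields.BalabanUV.T4Continuum.NE9CurChartTowerPiLatticeUniformClassW80VJ

open scoped InnerProductSpace ComplexConjugate BigOperators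
open Literature.MathematicalPhysics.QuantumFieldTheory.Balaban1983to89
open B11Eq103H1Complex B11Eq115Space B11Eq174Chart
open B11Eq111FrakG (nabla115)
open B13Contraction113 (QuadAnalytic)
open B9SectCLatticeCarrier (Bond bpos btgt unshift)
open B4Sect5Torus (TSite)
open B7Prop1Explicit (U1 Wcx boxVec)
open B7Prop2Explicit (pdev AvgClosed C0 c2' unitaryUnits avgClosed_unitaryUnits unitaryUnits_le_U1)
open B7Prop3Flat (c3)
open B9Eq315QTorus (perCfg cornerSite)
open B9Eq315QTower (towerP UlevOf)
open B9Eq326OperatorTower (QkW QkW_surjective laplaceAk)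
open B9Eq310HessianOperator (adTransportW)
open B9Eq310DeltaPrime (plaqHolU)
open B9Eq324DeltaPrimeATower (laplacePrimeAk)
open B9Eq3119DeltaPiTower (laplaceAkPi)
open B11Eq44COperatorTower (αT αT_le ulev_mem_U1_of_pdev)
open B11Eq44COperatorTowerGeometric (ulev_reg_of_pdev_geometric geomProfile_nonneg geomProfile_le_αT sum_geomProfile_le)
open B11Eq44CLetterTower (Cck)
open B9Thm311SmallFieldClosed (hRS_of_unitary)
open B9Eq315QTorusOnto (liftSite perSite_liftSite)
open B7Eq43AveragedSmallnessLevelFree (pdev_perCfg_le_of_plaq)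
open B7Eq43AveragedSmallnessLinearFeed (twoWindows_linear_feed)
open B9Thm311SitePrimeFormCoerciveTowerCanonical (exists_strong_site_coercive_tower_diagonal)
open B9Thm311LaplaceAkPiPositiveDiagonal (exists_laplaceAkPi_pos_diagonal_closed)
open B9Thm311LaplaceAkPositiveDiagonal (exists_laplaceAk_pos_diagonal_closed)
open B9Eq326OperatorTowerRealityUnitary (UlevOf_star_eq_inv forall_star_eq_inv_of_mem)
open B9Eq342GreenPrimeSupBound (norm_adTransportW_eq)
open Summit.QuantumFields.BalabanUV.T4Continuum.NE9CurChartTowerPiLatticeUniformClassW80 (cur_chart_exists_tower_pi_of_unitary_class_lattice_uniform_W80)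
open B11Eq98V0primeCurrentSlots (rieszτ rieszτ_apply)
open B11Eq98CurrentSlot (Jcur)
open B11Eq28JcurWindow (norm_Jcur_le_of_window levWeight_three_le)
open B11Eq98V0LettersLatticeUniform (curV0_quadBound_lattice_uniform)
open B11Eq80Current (W80)
open B11Eq63V0GroupCurrent (curV0)

variable {d : ℕ} (hd : 1 ≤ d) (L : ℕ) [NeZero L] (hL : 1 ≤ L) (hL2 : 2 ≤ L) (hL3 : 3 ≤ L) [Fact (0 < (L : ℝ))]
  {𝔸 : Type*} [CStarAlgebra 𝔸] [Nontrivial 𝔸] [FiniteDimensional ℂ 𝔸]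
  {W : Type*} [NormedAddCommGroup W] [InnerProductSpace ℂ W] [FiniteDimensional ℂ W] (φ : W ≃ₗ[ℂ] 𝔸)
  {Mφ Mφ' : ℝ} (hMφ : 0 ≤ Mφ) (hMφ' : 0 ≤ Mφ') (hφ : ∀ w, ‖φ w‖ ≤ Mφ * ‖w‖) (hφ' : ∀ X, ‖φ.symm X‖ ≤ Mφ' * ‖X‖)
  {a : ℝ} (ha : 0 < a) {a' : ℝ} (ha' : 0 < a')
  (τ : 𝔸 →ₗ[ℂ] ℂ) {Cτ : ℝ} (hτ : ∀ X, ‖τ X‖ ≤ Cτ * ‖X‖) (hCτ : 0 ≤ Cτ) {Mτ : ℝ} (hτm : ∀ X Y : 𝔸, ‖τ (X * Y)‖ ≤ Mτ * ‖X‖ * ‖Y‖) (hMτ : 0 ≤ Mτ)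
  {ρw : ℝ} (hρw : 0 ≤ ρw)
  (hτ₁ : ∀ X : 𝔸, τ (star X) = conj (τ X)) (hτ₂ : ∀ X Y : 𝔸, τ (X * Y) = τ (Y * X)) (hφτ : ∀ X Y : 𝔸, ⟪φ.symm X, φ.symm Y⟫_ℂ = τ (star X * Y))
  {α₀ : ℝ} (hα₀ : 0 < α₀) (hα3 : C0 d * α₀ ≤ 1 / 3) (hα4 : 4 * α₀ ≤ c2' d L)
  (hαL : 50 * (d + 1) * αT d L α₀ * (L : ℝ) ^ d ≤ 1 / 2)
  {ρ : ℝ} (hρ0 : 0 < ρ) (hρ : Real.exp (4 * (800 * ((d : ℝ) + 1) ^ 2 * ((d : ℝ) + 4)) * α₀) * (1 + 8 * (131072 * ((d : ℝ) + 1) ^ 2) * ρ) ≤ 2)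
  (hρ4 : 4 * ρ ≤ c3 d L) (hθ : 2 * d * B7Prop5GeneralLevels.thetaGen d L α₀ ≤ (L : ℝ) ^ 3 / 16) (hC3 : 2 * d * B7Prop5GeneralLevels.C3Gen d L * ρ ≤ 1)
  (hCτ1 : Cτ ≤ 1) {ω Ω : ℝ} (hω1 : 1 ≤ ω) (hΩ1 : 1 ≤ Ω) {MΔ : ℝ} (hMΔ : 0 ≤ MΔ)

-- deep definitional unfolding `laplaceAkPi` ↦ `laplaceALatticeK … (π†Δπ) …` in the statement (as the host)
set_option maxRecDepth 8192 in
set_option maxHeartbeats 1600000 in -- (I-7-W80)'s ≈ 60-binder theorem applied once + the letters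
include hd hL2 hL3 hMφ hMφ' hφ hφ' ha ha' hτ hCτ hτm hMτ hρw hτ₁ hτ₂ hφτ hα₀ hα3 hα4 hαL hρ0 hρ hρ4 hθ hC3 hCτ1 hω1 hΩ1 hMΔ in
/-- **THE LATTICE-UNIFORM `cur U` CHART ON PRINT's CLASS WITH THE CONCRETE `W80` AT THE CELL's LETTERS `ρ = rieszτ φ`, `τ`, `J = Jcur U`** — (I-7-W80) with the
W-letter block `(ρc, τc, M_r, M_t, C_V, R_V, J, M_J)` DISCHARGED (`‖rieszτ φ‖ ≤ M_φ²`; contractive trace `C_τ ≤ 1`; `C_V` of `B11Eq98V0LettersLatticeUniform` at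
`α ≤ α₀`, `R_V = 1/16`; `‖Jcur U‖ ≤ ω³`); displayed: `Δπ`, `‖Δπ‖ ≤ M_Δ`, the profile bounds (one new: `w̲₁,₂⁻¹ ≤ Ω`). [folklore]
[cite: Balaban1985BackgroundPropagators, (3.122) p.420, (3.35)–(3.37) p.396, Thm 3.12 p.423, Thm 3.13 p.426; Balaban1985Variational, (27)–(28) p.282, (80) p.290, Prop. 4 (97)–(98) p.293, (103) p.293, Prop. 6 (117)–(121) p.295; Balaban1985Averaging, (18) p.21, Prop. 2 p.26] -/
theorem cur_chart_exists_tower_pi_of_unitary_class_lattice_uniform_W80VJ :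
    ∃ α₁ j₁ ε₄ εC Rb R' : ℝ, 0 < α₁ ∧ 0 < j₁ ∧ 0 < Rb ∧ 0 < R' ∧
      ∀ (n : ℕ) (η : ℝ) [Fact (0 < η)] (hηL : η * (L : ℝ) ^ (n + 1) = 1) (c₀ c₁ : ℝ) [Fact (0 < c₀)] [Fact (0 < c₁)]
        (_hw : c₀ * ((L : ℝ) ^ (n + 1)) ^ d = c₁) (_hc₀η : c₀ = η ^ d) (_hρ : |η| ^ d / c₀ ≤ ρw) (m : Fin d → ℕ) [∀ i, NeZero (m i)] (_hm : ∀ i, 1 ≤ m i)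
        (U : Bond d (towerP L m (n + 1)) → 𝔸ˣ) (hUG : ∀ (x : B7Prop1Explicit.Site d) (κ : Fin d), perCfg (towerP L m (n + 1)) U x κ ∈ unitaryUnits 𝔸)
        (α : ℝ) (_hα : 0 ≤ α) (_hαle : α ≤ α₁) (_hUη : ∀ b, ‖(U b : 𝔸) - 1‖ ≤ α * η)
        (_hpl : ∀ p : B9SectCLatticeCarrier.Plaq d (towerP L m (n + 1)), ‖(plaqHolU U p : 𝔸) - 1‖ ≤ α * η ^ 2)
        (_hUgrad : ∀ (x : TSite d (towerP L m (n + 1))) (μ : Fin d), ‖(U (x, μ) : 𝔸) - U (unshift μ x, μ)‖ ≤ α * η ^ 2)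
        (j₀ : ℝ) (_hJ : ∀ μ y, ‖B9Eq39Adjoint.J (fun μ => B9Eq33CovDerivVector.shiftEquiv μ) (fun μ y => U (y, μ)) η μ y‖ ≤ j₀) (_hj : j₀ ≤ j₁)
        (lev₀ : Bond d (towerP L m (n + 1)) → ℕ) (lev₁ : Bond d (towerP L m (n + 1)) × Fin d → ℕ) (levB : Bond d m → ℕ) (_hlev : ∀ b, n + 1 ≤ lev₀ b)
        (_hw₀ : (NegSup.wSup (levWeight (L : ℝ) η lev₀ 1) : ℝ) ≤ ω) (_hw₁ : (NegSup.wSup (levWeight (L : ℝ) η lev₁ 2) : ℝ) ≤ ω)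
        (_hw₃ : (NegSup.wInvSup (levWeight (L : ℝ) η lev₀ 3) : ℝ) ≤ Ω) (_hwB : (NegSup.wInvSup (levWeight (L : ℝ) η levB 0) : ℝ) ≤ Ω)
        (_hw₁' : (NegSup.wInvSup (levWeight (L : ℝ) η lev₁ 2) : ℝ) ≤ Ω)
        (Δπ : Space115 (L : ℝ) η lev₀ lev₁ (nabla115 η U) →L[ℂ] NegSize (L : ℝ) η lev₀ 3 𝔸) (_hΔn : ‖Δπ‖ ≤ MΔ),
      ∃ h52 : pdev (perCfg (towerP L m (n + 1)) U) < α₀ * (((L : ℝ) ^ (n + 1))⁻¹) ^ 2,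
      ∃ hpos' : ∀ x : SiteL2K ℂ d (towerP L m (n + 1)) c₀ W, x ≠ 0 →
          0 < RCLike.re ⟪x, laplacePrimeAk L m n φ η U a' (c₁ := c₁) x⟫_ℂ,
      ∃ hposπ : ∀ x : BondL2K ℂ d (towerP L m (n + 1)) c₀ W, x ≠ 0 →
          0 < RCLike.re ⟪x, laplaceAkPi L m n φ τ η U a' hpos' hL (fun j => αT d L α₀ * (((L : ℝ) ^ min (j + 1) (n + 1))⁻¹) ^ 2)
            (fun j => (geomProfile_le_αT (d := d) L (n + 1) hL hα₀.le j).trans (αT_le hL hα4))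
            (ulev_mem_U1_of_pdev L m (n + 1) U hL2 (avgClosed_unitaryUnits d L) hUG hα₀ hα3 hα4 h52)
            (ulev_reg_of_pdev_geometric L m (n + 1) U hL2 (avgClosed_unitaryUnits d L) hUG hα₀ hα3 hα4 h52) (c₁ := c₁) a x⟫_ℂ,
        DifferentiableOn ℂ (chartHB (frakGLatticeCLM (lev₀ := lev₀) φ hposπ
              (QkW_surjective L m n φ U hL _ _ _ _ fun j => le_trans (mul_le_mul_of_nonneg_right (mul_le_mul_of_nonneg_left
                (geomProfile_le_αT (d := d) L (n + 1) hL hα₀.le j) (by positivity)) (by positivity)) hαL) lev₁ (nabla115 η U))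
            0 (W80 (rieszτ φ) (LinearMap.toContinuousLinearMap τ) U (H1LatticeCLM (lev₀ := lev₀) (levB := levB) φ hposπ
              (QkW_surjective L m n φ U hL _ _ _ _ fun j => le_trans (mul_le_mul_of_nonneg_right (mul_le_mul_of_nonneg_left
                (geomProfile_le_αT (d := d) L (n + 1) hL hα₀.le j) (by positivity)) (by positivity)) hαL) lev₁ (nabla115 η U))
              (Cck L m η (n + 1) U lev₀ lev₁ (nabla115 η U) levB) εC (Jcur (L := (L : ℝ)) (η := η) (lev₀ := lev₀) U) Δπ) 0 (fun A' => A' + solA (H1LatticeCLM (lev₀ := lev₀) (levB := levB) φ hposπ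
              (QkW_surjective L m n φ U hL _ _ _ _ fun j => le_trans (mul_le_mul_of_nonneg_right (mul_le_mul_of_nonneg_left
                (geomProfile_le_αT (d := d) L (n + 1) hL hα₀.le j) (by positivity)) (by positivity)) hαL) lev₁ (nabla115 η U)) 0
              (Cck L m η (n + 1) U lev₀ lev₁ (nabla115 η U) levB) 0 εC A') ε₄
            (H1LatticeCLM (lev₀ := lev₀) (levB := levB) φ hposπ
              (QkW_surjective L m n φ U hL _ _ _ _ fun j => le_trans (mul_le_mul_of_nonneg_right (mul_le_mul_of_nonneg_left
                (geomProfile_le_αT (d := d) L (n + 1) hL hα₀.le j) (by positivity)) (by positivity)) hαL) lev₁ (nabla115 η U)))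
          (ball (0 : NegSize (L : ℝ) η levB 0 𝔸) Rb) ∧
        MapsTo (chartHB (frakGLatticeCLM (lev₀ := lev₀) φ hposπ
              (QkW_surjective L m n φ U hL _ _ _ _ fun j => le_trans (mul_le_mul_of_nonneg_right (mul_le_mul_of_nonneg_left
                (geomProfile_le_αT (d := d) L (n + 1) hL hα₀.le j) (by positivity)) (by positivity)) hαL) lev₁ (nabla115 η U))
            0 (W80 (rieszτ φ) (LinearMap.toContinuousLinearMap τ) U (H1LatticeCLM (lev₀ := lev₀) (levB := levB) φ hposπ
              (QkW_surjective L m n φ U hL _ _ _ _ fun j => le_trans (mul_le_mul_of_nonneg_right (mul_le_mul_of_nonneg_left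
                (geomProfile_le_αT (d := d) L (n + 1) hL hα₀.le j) (by positivity)) (by positivity)) hαL) lev₁ (nabla115 η U))
              (Cck L m η (n + 1) U lev₀ lev₁ (nabla115 η U) levB) εC (Jcur (L := (L : ℝ)) (η := η) (lev₀ := lev₀) U) Δπ) 0 (fun A' => A' + solA (H1LatticeCLM (lev₀ := lev₀) (levB := levB) φ hposπ
              (QkW_surjective L m n φ U hL _ _ _ _ fun j => le_trans (mul_le_mul_of_nonneg_right (mul_le_mul_of_nonneg_left
                (geomProfile_le_αT (d := d) L (n + 1) hL hα₀.le j) (by positivity)) (by positivity)) hαL) lev₁ (nabla115 η U)) 0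
              (Cck L m η (n + 1) U lev₀ lev₁ (nabla115 η U) levB) 0 εC A') ε₄
            (H1LatticeCLM (lev₀ := lev₀) (levB := levB) φ hposπ
              (QkW_surjective L m n φ U hL _ _ _ _ fun j => le_trans (mul_le_mul_of_nonneg_right (mul_le_mul_of_nonneg_left
                (geomProfile_le_αT (d := d) L (n + 1) hL hα₀.le j) (by positivity)) (by positivity)) hαL) lev₁ (nabla115 η U)))
          (ball (0 : NegSize (L : ℝ) η levB 0 𝔸) Rb) (ball (0 : Space115 (L : ℝ) η lev₀ lev₁ (nabla115 η U)) R') ∧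
        chartHB (frakGLatticeCLM (lev₀ := lev₀) φ hposπ
              (QkW_surjective L m n φ U hL _ _ _ _ fun j => le_trans (mul_le_mul_of_nonneg_right (mul_le_mul_of_nonneg_left
                (geomProfile_le_αT (d := d) L (n + 1) hL hα₀.le j) (by positivity)) (by positivity)) hαL) lev₁ (nabla115 η U))
            0 (W80 (rieszτ φ) (LinearMap.toContinuousLinearMap τ) U (H1LatticeCLM (lev₀ := lev₀) (levB := levB) φ hposπ
              (QkW_surjective L m n φ U hL _ _ _ _ fun j => le_trans (mul_le_mul_of_nonneg_right (mul_le_mul_of_nonneg_left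
                (geomProfile_le_αT (d := d) L (n + 1) hL hα₀.le j) (by positivity)) (by positivity)) hαL) lev₁ (nabla115 η U))
              (Cck L m η (n + 1) U lev₀ lev₁ (nabla115 η U) levB) εC (Jcur (L := (L : ℝ)) (η := η) (lev₀ := lev₀) U) Δπ) 0 (fun A' => A' + solA (H1LatticeCLM (lev₀ := lev₀) (levB := levB) φ hposπ
              (QkW_surjective L m n φ U hL _ _ _ _ fun j => le_trans (mul_le_mul_of_nonneg_right (mul_le_mul_of_nonneg_left
                (geomProfile_le_αT (d := d) L (n + 1) hL hα₀.le j) (by positivity)) (by positivity)) hαL) lev₁ (nabla115 η U)) 0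
              (Cck L m η (n + 1) U lev₀ lev₁ (nabla115 η U) levB) 0 εC A') ε₄
            (H1LatticeCLM (lev₀ := lev₀) (levB := levB) φ hposπ
              (QkW_surjective L m n φ U hL _ _ _ _ fun j => le_trans (mul_le_mul_of_nonneg_right (mul_le_mul_of_nonneg_left
                (geomProfile_le_αT (d := d) L (n + 1) hL hα₀.le j) (by positivity)) (by positivity)) hαL) lev₁ (nabla115 η U)) 0 = 0 := by
  classical
  have hω : 0 ≤ ω := zero_le_one.trans hω1
  have hΩ : 0 ≤ Ω := zero_le_one.trans hΩ1
  -- the lattice-free V₀-letter `C_V` at `‖ρ‖ ≤ M_φ²`, `‖τ‖ ≤ 1`, `α ≤ α₀`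
  obtain ⟨CV, hCVdef⟩ : ∃ CV : ℝ, CV = 1024 * ((d - 1 : ℕ) : ℝ) * (ω * Ω) ^ 3 * (Mφ * Mφ) * (α₀ * 1 * ω ^ 2 + 1 / 16)
      + ((d - 1 : ℕ) : ℝ) * (ω * Ω) ^ 3 * (136 + 2 * (ω * Ω)) * (Mφ * Mφ) * 1 := ⟨_, rfl⟩
  have hCV : 0 ≤ CV := by rw [hCVdef]; positivity
  obtain ⟨α₁, j₁, ε₄, εC, Rb, R', hα₁, hj₁, hRb0, hR'0, H⟩ :=
    cur_chart_exists_tower_pi_of_unitary_class_lattice_uniform_W80 hd L hL hL2 hL3 φ hMφ hMφ' hφ hφ' ha ha' τ hτ hCτ hτm hMτ hρw hτ₁ hτ₂ hφτ hα₀ hα3 hα4 hαL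
      hρ0 hρ hρ4 hθ hC3 hω hΩ (CV := CV) (RV := 1 / 16) (Mr := Mφ * Mφ) (Mt := 1) (MJ := ω ^ 3) hCV (by norm_num) (mul_nonneg hMφ hMφ) zero_le_one
      (by positivity) hMΔ
  refine ⟨min α₁ α₀, min j₁ 1, ε₄, εC, Rb, R', lt_min hα₁ hα₀, lt_min hj₁ one_pos, hRb0, hR'0, ?_⟩
  intro n η _ hηL c₀ c₁ _ _ hw hc₀η hρ' m _ hm U hUG α hα0 hαle hUη hpl hUgrad j₀ hJ hj' lev₀ lev₁ levB hlev hw₀ hw₁ hw₃ hwB hw₁' Δπ hΔn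
  have hη0 : 0 < η := Fact.out
  have hL1 : (1 : ℝ) ≤ (L : ℝ) := by exact_mod_cast hL
  have hαle₁ : α ≤ α₁ := hαle.trans (min_le_left _ _)
  have hαle₀ : α ≤ α₀ := hαle.trans (min_le_right _ _)
  have hj₁' : j₀ ≤ j₁ := hj'.trans (min_le_left _ _)
  have hj1 : j₀ ≤ 1 := hj'.trans (min_le_right _ _)
  -- the class: `U(b)` unitary, `U(b)⋆ = U(b)⁻¹`, `U(b) ∈ U1`
  have hUS : ∀ b, U b ∈ unitaryUnits 𝔸 := fun b => by
    have h := hUG (liftSite b.1) b.2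
    rwa [B9Eq315QTorus.perCfg_apply, perSite_liftSite] at h
  have hUst : ∀ b, star (U b : 𝔸) = (((U b)⁻¹ : 𝔸ˣ) : 𝔸) := forall_star_eq_inv_of_mem hUS
  have hUb : ∀ b, U b ∈ U1 𝔸 := fun b => unitaryUnits_le_U1 (hUS b)
  -- the trace as a continuous functional: tracial, ⋆-compatible, contractive
  have hτc2 : ∀ a b : 𝔸, LinearMap.toContinuousLinearMap τ (a * b) = LinearMap.toContinuousLinearMap τ (b * a) := fun a b => hτ₂ a b
  have hτcs : ∀ a : 𝔸, LinearMap.toContinuousLinearMap τ (star a) = starRingEnd ℂ (LinearMap.toContinuousLinearMap τ a) := fun a => hτ₁ a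
  have hτc1 : ∀ X : 𝔸, ‖LinearMap.toContinuousLinearMap τ X‖ ≤ ‖X‖ := fun X =>
    (hτ X).trans (mul_le_of_le_one_left (norm_nonneg X) hCτ1)
  have hτn : ‖LinearMap.toContinuousLinearMap τ‖ ≤ 1 :=
    ContinuousLinearMap.opNorm_le_bound _ zero_le_one fun X => by simpa only [one_mul] using hτc1 X
  -- `‖rieszτ φ‖ ≤ M_φ²`
  have hρn : ‖rieszτ (𝔸 := 𝔸) φ‖ ≤ Mφ * Mφ := by
    refine ContinuousLinearMap.opNorm_le_bound _ (mul_nonneg hMφ hMφ) fun ℓ => ?_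
    have hφL : ‖(haveI : FiniteDimensional ℂ 𝔸 := LinearEquiv.finiteDimensional φ;
        LinearMap.toContinuousLinearMap φ.toLinearMap)‖ ≤ Mφ :=
      ContinuousLinearMap.opNorm_le_bound _ hMφ fun w => by simpa using hφ w
    rw [rieszτ_apply, norm_star]
    calc ‖φ ((InnerProductSpace.toDual ℂ W).symm (ℓ.comp (haveI : FiniteDimensional ℂ 𝔸 := LinearEquiv.finiteDimensional φ;
            LinearMap.toContinuousLinearMap φ.toLinearMap)))‖
        ≤ Mφ * ‖(InnerProductSpace.toDual ℂ W).symm (ℓ.comp (haveI : FiniteDimensional ℂ 𝔸 := LinearEquiv.finiteDimensional φ;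
            LinearMap.toContinuousLinearMap φ.toLinearMap))‖ := hφ _
      _ = Mφ * ‖ℓ.comp (haveI : FiniteDimensional ℂ 𝔸 := LinearEquiv.finiteDimensional φ;
            LinearMap.toContinuousLinearMap φ.toLinearMap)‖ := by rw [LinearIsometryEquiv.norm_map]
      _ ≤ Mφ * (‖ℓ‖ * ‖(haveI : FiniteDimensional ℂ 𝔸 := LinearEquiv.finiteDimensional φ;
            LinearMap.toContinuousLinearMap φ.toLinearMap)‖) := by
          gcongr; exact ContinuousLinearMap.opNorm_comp_le _ _
      _ ≤ Mφ * (‖ℓ‖ * Mφ) := by gcongr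
      _ = Mφ * Mφ * ‖ℓ‖ := by ring
  -- the profile letter `w̲₀⁻¹ ≤ 1 ≤ Ω` from `j(b) ≥ n+1`, `L^{n+1}η = 1`
  have hΩ₀ : (NegSup.wInvSup (levWeight (L : ℝ) η lev₀ 1) : ℝ) ≤ Ω := by
    have h : NegSup.wInvSup (levWeight (L : ℝ) η lev₀ 1) ≤ 1 :=
      Finset.sup_le fun b _ => by
        refine inv_le_one_of_one_le₀ ?_
        rw [← NNReal.coe_le_coe, NegSup.coe_wNN (w := levWeight (L : ℝ) η lev₀ 1), levWeight_apply, pow_one, NNReal.coe_one]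
        calc (1 : ℝ) = (L : ℝ) ^ (n + 1) * η := by rw [mul_comm]; exact hηL.symm
          _ ≤ (L : ℝ) ^ lev₀ b * η := mul_le_mul_of_nonneg_right (pow_le_pow_right₀ hL1 (hlev b)) hη0.le
    have h' : ((NegSup.wInvSup (levWeight (L : ℝ) η lev₀ 1) : NNReal) : ℝ) ≤ 1 := by exact_mod_cast h
    exact h'.trans hΩ1
  -- the V₀-group's (98)-letter, SUPPLIED (lattice-free `C_V`, `R_V = 1/16`)
  have hqV : ∀ Y : Space115 (L : ℝ) η lev₀ lev₁ (nabla115 η U), ‖Y‖ < 1 / 16 →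
      ‖curV0 (lev₁ := lev₁) (Dc := nabla115 η U) (rieszτ φ) (LinearMap.toContinuousLinearMap τ) U Y‖ ≤ CV * ‖Y‖ ^ 2 := by
    intro Y hY
    refine (curV0_quadBound_lattice_uniform (L := (L : ℝ)) (η := η) (lev₀ := lev₀) (lev₁ := lev₁) (rieszτ φ)
      (LinearMap.toContinuousLinearMap τ) hτc2 hτcs hτc1 hL1 hUb hUst hα0 hpl hω1 hΩ1 hw₀ hΩ₀ hw₁' Y hY).trans ?_
    rw [hCVdef]
    have hω0 : 0 < ω := by linarith
    have hΩ0 : 0 < Ω := by linarith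
    gcongr
  -- the current letter `M_J := ω³` from the window `j₀ ≤ j₁ ≤ 1`
  have hJn : ‖Jcur (L := (L : ℝ)) (η := η) (lev₀ := lev₀) U‖ ≤ ω ^ 3 := by
    have hj0 : (0 : ℝ) ≤ max j₀ 0 := le_max_right _ _
    have hJ' : ∀ μ y, ‖B9Eq39Adjoint.J (fun μ => B9Eq33CovDerivVector.shiftEquiv μ) (fun μ y => U (y, μ)) η μ y‖ ≤ max j₀ 0 :=
      fun μ y => (hJ μ y).trans (le_max_left _ _)
    have hwb : ∀ b, levWeight (L : ℝ) η lev₀ 1 b ≤ ω := fun b => (NegSup.le_wSup (w := levWeight (L : ℝ) η lev₀ 1) b).trans hw₀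
    have h := norm_Jcur_le_of_window (𝔸 := 𝔸) (L : ℝ) U hj0 (by positivity) (levWeight_three_le (L : ℝ) hwb) hJ'
    refine h.trans ?_
    have h1 : max j₀ 0 ≤ 1 := max_le hj1 zero_le_one
    calc ω ^ 3 * max j₀ 0 ≤ ω ^ 3 * 1 := by gcongr
      _ = ω ^ 3 := mul_one _
  exact H n η hηL c₀ c₁ hw hc₀η hρ' m hm U hUG α hα0 hαle₁ hUη hpl hUgrad j₀ hJ hj₁' lev₀ lev₁ levB hlev hw₀ hw₁ hw₃ hwB
    (rieszτ φ) (LinearMap.toContinuousLinearMap τ) hρn hτn hqV (Jcur (L := (L : ℝ)) (η := η) (lev₀ := lev₀) U) Δπ hJn hΔn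

end Summit.QuantumFields.BalabanUV.T4Continuum.NE9CurChartTowerPiLatticeUniformClassW80VJ
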